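import Mathlib.Analysis.Calculus.ContDiff.Operations
import Literature.Probability.Percolation.LongRangeKernelPercolationProofs
import HarnessLib

/-!
# Stub `stub_contDiff` of crux `ModelFacts` (stmt-CriticalPhenomena-16064), line `pushforward`

Crux: `Summit.CriticalPhenomena.PercolationContinuityZ3.Theses.PercExchangeRateTransport.ModelFacts`
(bookkeeping for the label-coupled anisotropic bond-percolation family on `ℤ²×ℤ`), registered
skeleton `Cruxes/ModelFacts/Lines/pushforward.lean`. This file proves the registered stub

`stub_contDiff` — *smoothness of cylinder probabilities in the parameters*: for an event `B`
determined by a finite set `K` of bonds of `ℤ³` and a two-parameter family of parameter fields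
`q x`, the map `x ↦ (prodBernoulli (q x)).real B` is `C^m` on `S` as soon as every coordinate
`x ↦ q x e`, `e ∈ K`, is.

Argument (the `C^m` companion of the tree lemma
`Literature.Probability.Percolation.continuous_prodBernoulli_real_of_determinedBy`, whose proof is
copied with `ContDiffOn` in place of `Continuous`): `B` is the finite disjoint union of the
cylinders `[T]_K`, `T ⊆ K`, `↑T ∈ B` (`DeterminedBy.eq_biUnion_localCylinder`), each of
probability `∏_{i ∈ K} (q_i if i ∈ T else 1 - q_i)` (`prodBernoulli_real_localCylinder`); finite
sums and products of `C^m` functions are `C^m` (`ContDiffOn.sum`, `contDiffOn_prod`,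
`contDiffOn_const`, `ContDiffOn.sub`). (Grimmett 1999, §7.3 p. 162: "`P_p(A)` is a finite
polynomial".)

Tree lemmas used: `DeterminedBy.eq_biUnion_localCylinder`, `measurableSet_localCylinder`,
`prodBernoulli_real_localCylinder`, `measureReal_biUnion_finset` (Mathlib).
-/

noncomputable section

open MeasureTheory
open Literature.Probability.Percolation Literature.Probability.LatticeModels

namespace Summit.CriticalPhenomena.PercolationContinuityZ3.Theorems.ModelFacts

namespace ContDiffStub

/-- **Smoothness of finite-dimensional probabilities in the parameters** (general index type and
general normed parameter space). If the parameters `p x : ι → [0,1]` are `C^m` on `S` in `x` at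
every coordinate of a finite set `F`, then `x ↦ (prodBernoulli (p x))(A)` is `C^m` on `S` for every
event `A` determined by `F`: `A` is the finite disjoint union of the cylinders `[T]_F`, `T ⊆ F`,
whose probabilities are finite products of `p_i`, `1 - p_i` (Grimmett 1999, §7.3 p. 162:
"`P_p(A)` is a finite polynomial"). [folklore] -/
theorem contDiffOn_prodBernoulli_real_of_determinedBy {ι : Type*} {X : Type*}
    [NormedAddCommGroup X] [NormedSpace ℝ X] {m : WithTop ℕ∞}
    (p : X → ι → unitInterval) {A : Set (Set ι)} {F : Finset ι} {S : Set X}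
    (hA : DeterminedBy A (↑F : Set ι))
    (hp : ∀ i ∈ F, ContDiffOn ℝ m (fun x => (p x i : ℝ)) S) :
    ContDiffOn ℝ m (fun x => (prodBernoulli (p x)).real A) S := by
  classical
  -- adapted from `Literature.Probability.Percolation.continuous_prodBernoulli_real_of_determinedBy`
  have hdisj : (↑(F.powerset.filter fun T : Finset ι => (↑T : Set ι) ∈ A) :
      Set (Finset ι)).PairwiseDisjoint
        fun T : Finset ι => localCylinder (↑F : Set ι) (↑T : Set ι) := by
    intro T hT T' hT' hne
    simp only [Finset.coe_filter, Finset.mem_powerset, Set.mem_setOf_eq] at hT hT'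
    rw [Function.onFun, Set.disjoint_left]
    intro ω hω hω'
    apply hne
    ext e
    constructor
    · intro he
      exact (hω' e (hT.1 he)).1 ((hω e (hT.1 he)).2 he)
    · intro he
      exact (hω e (hT'.1 he)).1 ((hω' e (hT'.1 he)).2 he)
  have hsum : ∀ x : X, (prodBernoulli (p x)).real A =
      ∑ T ∈ F.powerset.filter (fun T : Finset ι => (↑T : Set ι) ∈ A),
        (prodBernoulli (p x)).real (localCylinder (↑F : Set ι) (↑T : Set ι)) := by
    intro x
    conv_lhs => rw [DeterminedBy.eq_biUnion_localCylinder hA]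
    exact measureReal_biUnion_finset hdisj
      (fun T _ => measurableSet_localCylinder F.finite_toSet.countable _)
  simp_rw [hsum, prodBernoulli_real_localCylinder]
  refine ContDiffOn.sum fun T _ => contDiffOn_prod fun i hi => ?_
  by_cases hiT : i ∈ (↑T : Set ι)
  · simp only [hiT, if_true]; exact hp i hi
  · simp only [hiT, if_false]; exact contDiffOn_const.sub (hp i hi)

end ContDiffStub

/-- **Stub 2 of line `pushforward` (registered): smoothness of cylinder probabilities in the
parameters.** For an event `B` determined by a finite set `K` of pairs of sites of `ℤ³` and a
two-parameter family of parameter fields `q x`, the map `x ↦ (prodBernoulli (q x)).real B` is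
`C^m` on `S` as soon as every coordinate `x ↦ q x e`, `e ∈ K`, is (the `C^m` companion of the
tree's `continuous_prodBernoulli_real_of_determinedBy`; Grimmett 1999, §7.3 p. 162). [folklore] -/
theorem stub_contDiff :
    ∀ (K : Finset (Sym2 (Site 3))) (B : Set (Set (Sym2 (Site 3)))),
    DeterminedBy B (↑K : Set (Sym2 (Site 3))) →
    ∀ (m : WithTop ℕ∞) (q : ℝ × ℝ → Sym2 (Site 3) → unitInterval) (S : Set (ℝ × ℝ)),
      (∀ e ∈ K, ContDiffOn ℝ m (fun x : ℝ × ℝ => (q x e : ℝ)) S) →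
        ContDiffOn ℝ m (fun x : ℝ × ℝ => (prodBernoulli (q x)).real B) S := by
  intro K B hB m q S hq
  exact ContDiffStub.contDiffOn_prodBernoulli_real_of_determinedBy q hB hq

end Summit.CriticalPhenomena.PercolationContinuityZ3.Theorems.ModelFacts

end
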